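import Mathlib
import Summits.PneNP.PneNP.Theorems.Nc03AvoidResidualCoreReductionBfsB

/-!
# Route Nc03AvoidResidualCore, item `ResidualCoreReduction` — fundamental cycles of a BFS forest

Helper file for `stmt-PneNP-20227` (sequel of `…ReductionBfsB`; cell pnp-ideate). For an edge `e`
of `E` (meant: outside the BFS forest of `E`), the two ancestor chains of its endpoints up to their
first common vertex `lca`, closed by `e`, form a cycle, presented explicitly via depths (no graph
search): `cyc E e i` is its `i`-th edge (`i < clen = kb + ka + 1`, even), `bd E e i` the vertex
after it. We prove: consecutive edges share the boundary vertices, boundary sides alternate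
starting on side B, positive-index edges are distinct forest edges. The sequel turns this into a
balanced alternating trail. [folklore]
-/

set_option linter.dupNamespace false -- `Summit.PneNP.PneNP.…`: summit = sub-problem name (D-0017 single-conjunct layout)

namespace Summit.PneNP.PneNP.Theorems.Nc03Reduction

open Finset

namespace Bip

variable {ι W : Type*} (G : Bip ι W) [LinearOrder W]

noncomputable section
open Classical

/-! ## Fundamental cycles -/

variable [Fintype W] [LinearOrder ι] [Inhabited ι]

section Fcycle

variable (E : Finset ι) (e : ι)

/-- The heights at which the ancestor chain of the B-endpoint meets the chain of the A-endpoint. -/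
def mergeSet : Finset ℕ :=
  (range (G.depth E (G.eB e) + 1)).filter fun i =>
    ∃ m ∈ range (G.depth E (G.eA e) + 1), G.anc E i (G.eB e) = G.anc E m (G.eA e)

/-- The first meeting height on the B-side (junk `0` if the chains never meet). -/
def kb : ℕ := if h : (G.mergeSet E e).Nonempty then (G.mergeSet E e).min' h else 0

/-- The first common ancestor of the two endpoints. -/
def lca : W := G.anc E (G.kb E e) (G.eB e)

/-- The meeting height on the A-side. -/
def ka : ℕ := G.depth E (G.eA e) - G.depth E (G.lca E e)

/-- The number of edges of the fundamental cycle. -/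
def clen : ℕ := G.kb E e + G.ka E e + 1

/-- The `i`-th edge of the fundamental cycle: `e`, then up the B-chain, then down the A-chain. -/
def cyc (i : ℕ) : ι :=
  if i = 0 then e
  else if i ≤ G.kb E e then G.pe E (G.anc E (i - 1) (G.eB e))
  else G.pe E (G.anc E (G.kb E e + G.ka E e - i) (G.eA e))

/-- The vertex shared by the `i`-th and `(i+1)`-st edges of the cycle. -/
def bd (i : ℕ) : W :=
  if i ≤ G.kb E e then G.anc E i (G.eB e) else G.anc E (G.kb E e + G.ka E e - i) (G.eA e)

variable {E e}

/-- Membership in the meeting set. -/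
theorem mem_mergeSet {i : ℕ} : i ∈ G.mergeSet E e ↔
    i ≤ G.depth E (G.eB e) ∧ ∃ m, m ≤ G.depth E (G.eA e) ∧ G.anc E i (G.eB e) = G.anc E m (G.eA e) := by
  unfold mergeSet
  simp only [Finset.mem_filter, Finset.mem_range, Nat.lt_succ_iff]

/-- For an edge of `E`, the two chains meet (at the common root at the latest). -/
theorem mergeSet_nonempty (he : e ∈ E) : (G.mergeSet E e).Nonempty := by
  refine ⟨G.depth E (G.eB e), G.mem_mergeSet.2 ⟨le_rfl, G.depth E (G.eA e), le_rfl, ?_⟩⟩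
  rw [G.anc_depth, G.anc_depth]
  exact (G.root_eq_of_reach (G.adj_ends he).reach).symm

/-- The meeting height is a meeting height, and it is the least one. -/
theorem kb_spec (he : e ∈ E) :
    G.kb E e ≤ G.depth E (G.eB e) ∧
      (∃ m, m ≤ G.depth E (G.eA e) ∧ G.anc E (G.kb E e) (G.eB e) = G.anc E m (G.eA e)) ∧
      ∀ i < G.kb E e, ∀ m ≤ G.depth E (G.eA e), G.anc E i (G.eB e) ≠ G.anc E m (G.eA e) := by
  have hne := G.mergeSet_nonempty he
  have hkb : G.kb E e = (G.mergeSet E e).min' hne := by unfold kb; rw [dif_pos hne]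
  have hmem := Finset.min'_mem _ hne
  rw [← hkb] at hmem
  obtain ⟨hr, m, hm, hmeq⟩ := G.mem_mergeSet.1 hmem
  refine ⟨hr, ⟨m, hm, hmeq⟩, fun i hi m' hm' heq => ?_⟩
  have hi' : i ∈ G.mergeSet E e := G.mem_mergeSet.2 ⟨by omega, m', hm', heq⟩
  have := Finset.min'_le _ _ hi'
  rw [← hkb] at this
  omega

/-- The A-chain reaches the first common ancestor at height `ka`. -/
theorem anc_ka (he : e ∈ E) : G.anc E (G.ka E e) (G.eA e) = G.lca E e ∧ G.ka E e ≤ G.depth E (G.eA e) := by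
  obtain ⟨hkb, ⟨m, hm, hmeq⟩, -⟩ := G.kb_spec he
  have hd := G.depth_anc hm
  have hka : G.ka E e = m := by
    unfold ka lca; rw [hmeq, hd]; omega
  rw [hka]
  exact ⟨by unfold lca; rw [hmeq], hm⟩

/-- Depth of the first common ancestor from the B-side. -/
theorem depth_lca (he : e ∈ E) : G.depth E (G.lca E e) + G.kb E e = G.depth E (G.eB e) := by
  have hkb := (G.kb_spec he).1
  have h := G.depth_anc hkb
  unfold lca; omega

/-- Depth of the first common ancestor from the A-side. -/
theorem depth_lca' (he : e ∈ E) : G.depth E (G.lca E e) + G.ka E e = G.depth E (G.eA e) := by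
  obtain ⟨h1, h2⟩ := G.anc_ka he
  have h := G.depth_anc h2
  rw [h1] at h; omega

/-- The cycle has even length: `kb + ka` is odd. -/
theorem even_clen (he : e ∈ E) : Even (G.clen E e) := by
  have h1 := G.depth_lca he
  have h2 := G.depth_lca' he
  have h3 := G.depth_adj (G.adj_ends he)
  unfold clen
  rcases h3 with h3 | h3
  · exact ⟨G.kb E e, by omega⟩
  · exact ⟨G.ka E e, by omega⟩

/-- The boundary vertices on the B-chain. -/
theorem bd_of_le {i : ℕ} (hi : i ≤ G.kb E e) : G.bd E e i = G.anc E i (G.eB e) := by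
  unfold bd; rw [if_pos hi]

/-- The boundary vertices on the A-chain. -/
theorem bd_of_ge (he : e ∈ E) {i : ℕ} (hi : G.kb E e ≤ i) :
    G.bd E e i = G.anc E (G.kb E e + G.ka E e - i) (G.eA e) := by
  unfold bd
  split
  · have : i = G.kb E e := le_antisymm ‹_› hi
    subst this
    rw [show G.kb E e + G.ka E e - G.kb E e = G.ka E e by omega, (G.anc_ka he).1]; rfl
  · rfl

/-- The cycle edges `1 … kb` climb the B-chain: their endpoints are consecutive boundary vertices,
the lower one being the child. -/
theorem cyc_B (he : e ∈ E) {i : ℕ} (hi1 : 1 ≤ i) (hi : i ≤ G.kb E e) :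
    G.cyc E e i = G.pe E (G.bd E e (i - 1)) ∧ 0 < G.depth E (G.bd E e (i - 1)) ∧
      G.parent E (G.bd E e (i - 1)) = G.bd E e i := by
  have hkb := (G.kb_spec he).1
  rw [G.bd_of_le (by omega), G.bd_of_le hi]
  refine ⟨by unfold cyc; rw [if_neg (by omega), if_pos hi], ?_, ?_⟩
  · rw [G.depth_anc (by omega)]; omega
  · rw [show i = i - 1 + 1 by omega, G.anc_succ]; rfl

/-- The cycle edges `kb+1 … kb+ka` descend the A-chain: their endpoints are consecutive boundary
vertices, the upper one being the parent. -/
theorem cyc_A (he : e ∈ E) {i : ℕ} (hi1 : G.kb E e < i) (hi : i ≤ G.kb E e + G.ka E e) :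
    G.cyc E e i = G.pe E (G.bd E e i) ∧ 0 < G.depth E (G.bd E e i) ∧
      G.parent E (G.bd E e i) = G.bd E e (i - 1) := by
  have hka := (G.anc_ka he).2
  rw [G.bd_of_ge he (by omega), G.bd_of_ge he (by omega)]
  refine ⟨by unfold cyc; rw [if_neg (by omega), if_neg (by omega)], ?_, ?_⟩
  · rw [G.depth_anc (by omega)]
    have := G.depth_lca' he
    omega
  · rw [show G.kb E e + G.ka E e - (i - 1) = G.kb E e + G.ka E e - i + 1 by omega, G.anc_succ]

/-- The first boundary vertex is the B-endpoint of `e`. -/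
theorem bd_zero : G.bd E e 0 = G.eB e := by
  rw [G.bd_of_le (Nat.zero_le _)]; rfl

/-- The last boundary vertex is the A-endpoint of `e`. -/
theorem bd_last (he : e ∈ E) : G.bd E e (G.kb E e + G.ka E e) = G.eA e := by
  rw [G.bd_of_ge he (by omega), Nat.sub_self]; rfl

/-- Sides of boundary vertices alternate, starting on side B. -/
theorem side_bd (he : e ∈ E) : ∀ i ≤ G.kb E e + G.ka E e, G.side (G.bd E e i) = decide (Even i) := by
  intro i
  induction i with
  | zero => intro _; rw [G.bd_zero, G.sideB]; decide
  | succ i ih =>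
    intro hi
    have h0 := ih (by omega)
    have hdec : decide (Even (i + 1)) = !decide (Even i) := by
      by_cases h : Even i <;> simp [h, Nat.even_add_one]
    rw [hdec]
    rcases Nat.lt_or_ge i (G.kb E e) with h | h
    · -- edge `i+1` on the B-chain: `bd (i+1)` is the parent of `bd i`
      obtain ⟨-, hpos, hpar⟩ := G.cyc_B he (i := i + 1) (by omega) (by omega)
      rw [Nat.add_sub_cancel] at hpos hpar
      rw [← hpar, G.side_parent hpos, h0]
    · -- edge `i+1` on the A-chain: `bd i` is the parent of `bd (i+1)`
      obtain ⟨-, hpos, hpar⟩ := G.cyc_A he (i := i + 1) (by omega) (by omega)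
      rw [Nat.add_sub_cancel] at hpar
      have h1 := G.side_parent hpos
      rw [hpar, h0] at h1
      revert h1; cases G.side (G.bd E e (i + 1)) <;> cases decide (Even i) <;> simp

/-- The B-endpoint of a positive-index even cycle edge is the boundary vertex after it... stated
uniformly: for `1 ≤ i ≤ kb+ka`, both `bd (i-1)` and `bd i` are endpoints of `cyc i`. -/
theorem bd_mem_ends (he : e ∈ E) {i : ℕ} (hi1 : 1 ≤ i) (hi : i ≤ G.kb E e + G.ka E e) :
    G.bd E e (i - 1) ∈ G.ends (G.cyc E e i) ∧ G.bd E e i ∈ G.ends (G.cyc E e i) := by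
  rcases Nat.lt_or_ge (G.kb E e) i with h | h
  · obtain ⟨hc, hpos, hpar⟩ := G.cyc_A he h hi
    rw [hc, ← hpar]
    exact ⟨G.parent_mem_ends _ _, G.mem_ends_pe hpos⟩
  · obtain ⟨hc, hpos, hpar⟩ := G.cyc_B he hi1 h
    rw [hc, ← hpar]
    exact ⟨G.mem_ends_pe hpos, G.parent_mem_ends _ _⟩

/-- Positive-index cycle edges are forest edges (parent edges of positive-depth vertices). -/
theorem cyc_mem_forest (he : e ∈ E) {i : ℕ} (hi1 : 1 ≤ i) (hi : i ≤ G.kb E e + G.ka E e) :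
    G.cyc E e i ∈ G.forest E := by
  rcases Nat.lt_or_ge (G.kb E e) i with h | h
  · obtain ⟨hc, hpos, -⟩ := G.cyc_A he h hi
    rw [hc]; exact G.pe_mem_forest hpos
  · obtain ⟨hc, hpos, -⟩ := G.cyc_B he hi1 h
    rw [hc]; exact G.pe_mem_forest hpos

/-- The deeper endpoint of a positive-index cycle edge. -/
theorem deep_cyc (he : e ∈ E) {i : ℕ} (hi1 : 1 ≤ i) (hi : i ≤ G.kb E e + G.ka E e) :
    G.deep E (G.cyc E e i) = if i ≤ G.kb E e then G.bd E e (i - 1) else G.bd E e i := by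
  split
  · obtain ⟨hc, hpos, -⟩ := G.cyc_B he hi1 ‹_›
    rw [hc, G.deep_pe hpos]
  · obtain ⟨hc, hpos, -⟩ := G.cyc_A he (by omega) hi
    rw [hc, G.deep_pe hpos]

/-- Boundary vertices on the B-chain strictly below the meeting height are not on the A-chain. -/
theorem bd_B_ne_A (he : e ∈ E) {i m : ℕ} (hi : i < G.kb E e) (hm : m ≤ G.ka E e) :
    G.anc E i (G.eB e) ≠ G.anc E m (G.eA e) :=
  (G.kb_spec he).2.2 i hi m (le_trans hm (G.anc_ka he).2)

/-- The positive-index cycle edges are pairwise distinct. -/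
theorem cyc_injOn (he : e ∈ E) {i i' : ℕ} (hi1 : 1 ≤ i) (hi : i ≤ G.kb E e + G.ka E e)
    (hi'1 : 1 ≤ i') (hi' : i' ≤ G.kb E e + G.ka E e) (h : G.cyc E e i = G.cyc E e i') : i = i' := by
  have hd := congrArg (G.deep E) h
  rw [G.deep_cyc he hi1 hi, G.deep_cyc he hi'1 hi'] at hd
  have hkb := (G.kb_spec he).1
  have hka := (G.anc_ka he).2
  split at hd <;> split at hd
  · rw [G.bd_of_le (by omega), G.bd_of_le (by omega)] at hd
    have := G.anc_injOn (E := E) (w := G.eB e) (by omega) (by omega) hd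
    omega
  · rw [G.bd_of_le (by omega), G.bd_of_ge he (by omega)] at hd
    exact absurd hd (G.bd_B_ne_A he (by omega) (by omega))
  · rw [G.bd_of_ge he (by omega), G.bd_of_le (by omega)] at hd
    exact absurd hd.symm (G.bd_B_ne_A he (by omega) (by omega))
  · rw [G.bd_of_ge he (by omega), G.bd_of_ge he (by omega)] at hd
    have := G.anc_injOn (E := E) (w := G.eA e) (by omega) (by omega) hd
    omega

/-- The zeroth cycle edge is `e`. -/
theorem cyc_zero : G.cyc E e 0 = e := by unfold cyc; rw [if_pos rfl]

/-- A non-forest edge differs from all positive-index cycle edges. -/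
theorem cyc_ne_zero (he : e ∈ E) (heT : e ∉ G.forest E) {i : ℕ} (hi1 : 1 ≤ i)
    (hi : i ≤ G.kb E e + G.ka E e) : G.cyc E e i ≠ e :=
  fun h => heT (h ▸ G.cyc_mem_forest he hi1 hi)

end Fcycle

end

end Bip

end Summit.PneNP.PneNP.Theorems.Nc03Reduction
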